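import Literature.NumberTheory.LFunctions.MoebiusTwoPowerModuli
import Literature.NumberTheory.LFunctions.MoebiusCharacterSumBoundProofs
import Literature.Barriers.Parity.SiegelZeroPrimePairsProofs
import HarnessLib

/-!
# Möbius twisted by characters to `2`-power moduli (Green 2012, Theorem 3), proved

Topic `Literature/NumberTheory/LFunctions`. Everything in this file is PROVED (theorems only); it
discharges the named fact `Literature.NumberTheory.LFunctions.green_moebius_character_twoPower`
(`MoebiusTwoPowerModuli.lean`; B. Green, *On (not) computing the Möbius function using bounded
depth circuits*, Combin. Probab. Comput. 21 (2012), Theorem 3 of the arXiv version 1103.4991, §4):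

> for some absolute `c₂ > 0`: if `χ` is a Dirichlet character to modulus `q = 2^t`,
> `q ≤ e^{c₂√log N}`, then `E_{0 ≤ x ≤ N−1} μ(x)χ(x) = O(e^{−c₂√log N})`

(rendered with the denominator `N` cleared and an explicit absolute implied constant).

## The argument (Green's proof of Theorem 3, on top of the tree's Landau engine)

Green: "By standard techniques of analytic number theory (Perron's formula and the classical
zero-free region for Dirichlet `L`-functions) one may establish the bound … for all Dirichlet
characters `χ` to modulus `q ≤ e^{c₂√log N}`, provided only that `L(s, χ)` has no exceptional
zero [Montgomery–Vaughan, Exercise 11.3.7 with Theorem 11.4 / (11.7)]. … We now specialise to the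
case `q = 2^t`. … there are only three nonprincipal primitive real Dirichlet characters with
conductor a power of two [`χ₄`, `χ₈`, `χ₄χ₈`] … (In fact it suffices to know that `L(1, χ) ≠ 0` …
This implies that `L(s, χ) ≠ 0` for `s ∈ [1 − c', 1]` for some `c'` by continuity, which already
means that there are no exceptional zeros.)"

We follow this literally, the "standard techniques" being the tree's PROVED Landau engine with an
exceptional zero, exactly as in the proof of Montgomery–Vaughan §11.3 Exercise 8
(`MoebiusCharacterSumBoundProofs.lean`, `Literature.NumberTheory.LFunctions.MoebiusCharacterSumBound_holds`):

* `MoebiusTwist.exists_excPsiData_all` + `ExcPsiData.exists_psi_bound` give, for EVERY modulus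
  `q`, every `χ` mod `q`, `|w| ≤ 1`, `x ≥ 64` with `log q ≤ √log x`,
  `|⌊x⌋ + λ Re(w M(x, χ)) − x + α x^β/β| ≤ A(C₀q² + 1) x e^{−(c/80)√log x}`, `λ = 1/(K log 4q + 1)`,
  where either `α = 0` or `χ ≠ χ₀` is quadratic and `β ∈ [1/2, 1)` is a real zero of `L(s, χ)`.
* No exceptional zero for `2`-power moduli (`MoebiusTwoPower.exists_realZero_le`): a character
  `χ` mod `2^t` with `χ² = 1` factors through `8` (`factorsThrough_eight`, iterating the tree's
  `Literature.Barriers.Parity.SiegelCorr.factorsThrough_div_two_of_sixteen_dvd`: the kernel of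
  `(ℤ/2^t)ˣ → (ℤ/2^{t−1})ˣ` consists of squares once `16 ∣ 2^t`), so `L(s, χ)` is `L(s, χ₀)` for a
  character `χ₀ ≠ 1` mod `8` up to a non-vanishing Euler factor (Mathlib `LFunction_changeLevel`),
  and for the finitely many `χ₀` mod `8`, `L(1, χ₀) ≠ 0` (Mathlib) and continuity give a uniform
  `δ > 0` with no real zero in `[1 − δ, 1]`; hence `x^β ≤ x^{1−δ} ≤ e^{c'²/4δ} x e^{−c'√log x}`
  (`exists_rpow_realZero_le`), replacing Siegel's theorem in MV's argument.
* Assembly (`green_moebius_character_twoPower_holds`): with `c'` the engine's constant take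
  `c₂ = c'/4`; for `q = 2^t ≤ e^{c₂√log N}` one has `log q ≤ √log N`, `q² e^{−c'√L} ≤ e^{−2c₂√L}`,
  `K log 4q + 1 ≪ √L`, and `√L e^{−c₂√L} ≪ 1`, `√L ≤ N e^{−c₂√L}`; `N < 64` is trivial, and
  Green's range `0 ≤ x ≤ N − 1` differs from `1 ≤ n ≤ N` by one term of modulus `≤ 1`.

## References

* B. Green, *On (not) computing the Möbius function using bounded depth circuits*, Combin.
  Probab. Comput. 21 (2012) 942–951; arXiv:1103.4991, §4, Theorem 3 and its proof (`Green2012`).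
* H. L. Montgomery, R. C. Vaughan, *Multiplicative Number Theory I*, CUP 2007, §11.3 Exercises 7–8,
  Theorem 11.16 (`MontgomeryVaughan2007`).
-/

noncomputable section

open Complex Filter Topology Metric Set Finset
open scoped ArithmeticFunction.Moebius ComplexConjugate

namespace Literature.NumberTheory.LFunctions

namespace MoebiusTwoPower

open DirichletCharacter

/-! ## Quadratic characters to modulus `2^t` factor through `8` -/

/-- Every character `χ` to modulus `2^{k+3}` with `χ² = 1` factors through `8`: iterate the
tree's `Literature.Barriers.Parity.SiegelCorr.factorsThrough_div_two_of_sixteen_dvd` (a quadratic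
character mod `q`, `16 ∣ q`, factors through `q/2`, the kernel of `(ℤ/q)ˣ → (ℤ/(q/2))ˣ` consisting
of squares). Green: the real characters of conductor dividing `2^e` are `χ₀, χ₄, χ₈, χ₄χ₈`, "any
Dirichlet character of conductor dividing `2^e` is determined by its values at `−1` and `5`".
[cite: Green2012, proof of Theorem 3] -/
theorem factorsThrough_eight : ∀ (k : ℕ) (χ : DirichletCharacter ℂ (2 ^ (k + 3))), χ ^ 2 = 1 →
    χ.FactorsThrough 8
  | 0, χ, _ => FactorsThrough.same_level χ
  | k + 1, χ, hχ => by
    have h16 : 16 ∣ 2 ^ (k + 1 + 3) := ⟨2 ^ k, by ring⟩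
    have hF := Literature.Barriers.Parity.SiegelCorr.factorsThrough_div_two_of_sixteen_dvd χ
      (MulChar.isQuadratic_iff_sq_eq_one.2 hχ) h16
    have hdiv : 2 ^ (k + 1 + 3) / 2 = 2 ^ (k + 3) := by
      rw [show k + 1 + 3 = (k + 3) + 1 by ring, pow_succ, Nat.mul_div_cancel _ two_pos]
    rw [hdiv] at hF
    obtain ⟨h, χ₁, hχ₁⟩ := hF
    have hχ₁2 : χ₁ ^ 2 = 1 := by
      rw [← changeLevel_eq_one_iff (χ := χ₁ ^ 2) h, map_pow, ← hχ₁, hχ]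
    obtain ⟨h8, χ₀, hχ₀⟩ := factorsThrough_eight k χ₁ hχ₁2
    exact ⟨h8.trans h, χ₀, by rw [hχ₁, hχ₀, ← changeLevel_trans χ₀ h8 h]⟩

/-- `2` is not a unit mod `8`, so `χ₀(2) = 0` for every character `χ₀` mod `8`. [folklore] -/
theorem apply_two_eq_zero (χ₀ : DirichletCharacter ℂ 8) : χ₀ ((2 : ℕ) : ZMod 8) = 0 :=
  χ₀.map_nonunit (by rw [ZMod.isUnit_iff_coprime]; decide)

/-- **Zeros of `L(s, χ)`, `χ ≠ χ₀` mod `2^t` with `χ² = 1`, are zeros of some `L(s, χ₀)` with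
`χ₀ ≠ 1` mod `8`.** For `t ≤ 3` lift `χ` to modulus `8`
(`L(s, χ↑8) = L(s, χ) ∏_{p ∣ 8}(1 − χ(p)p^{−s})`); for `t ≥ 3` write `χ = χ₀↑2^t` with `χ₀` mod `8`
(`factorsThrough_eight`) and use `L(s, χ) = L(s, χ₀)(1 − χ₀(2)2^{−s}) = L(s, χ₀)` (Mathlib
`LFunction_changeLevel`). Green: "Without loss of generality we may suppose that `q` is the
conductor of `χ` … only three nonprincipal primitive real Dirichlet characters with conductor a
power of two". [cite: Green2012, proof of Theorem 3] -/
theorem exists_mod_eight_of_LFunction_eq_zero (t : ℕ) (χ : DirichletCharacter ℂ (2 ^ t))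
    (hχ2 : χ ^ 2 = 1) (hχ1 : χ ≠ 1) {s : ℂ} (hs : χ.LFunction s = 0) :
    ∃ χ₀ : DirichletCharacter ℂ 8, χ₀ ≠ 1 ∧ χ₀.LFunction s = 0 := by
  rcases le_or_gt t 3 with ht | ht
  · -- lift to modulus `8 = 2^3`
    have h : 2 ^ t ∣ 8 := by simpa using Nat.pow_dvd_pow 2 ht
    refine ⟨changeLevel h χ, fun h1 ↦ hχ1 ((changeLevel_eq_one_iff h).1 h1), ?_⟩
    rw [LFunction_changeLevel h χ (Or.inl hχ1), hs, zero_mul]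
  · -- descend to modulus `8`
    obtain ⟨k, rfl⟩ : ∃ k, t = k + 3 := ⟨t - 3, by omega⟩
    obtain ⟨h, χ₀, hχ₀⟩ := factorsThrough_eight k χ hχ2
    have hχ₀1 : χ₀ ≠ 1 := by
      rintro rfl
      exact hχ1 (by rw [hχ₀, map_one])
    refine ⟨χ₀, hχ₀1, ?_⟩
    have hL := LFunction_changeLevel h χ₀ (s := s) (Or.inl hχ₀1)
    rw [← hχ₀, hs] at hL
    have hpf : (2 ^ (k + 3)).primeFactors = {2} :=
      Nat.primeFactors_prime_pow (by omega) Nat.prime_two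
    rw [hpf, Finset.prod_singleton, apply_two_eq_zero, zero_mul, sub_zero, mul_one] at hL
    exact hL.symm

/-! ## No exceptional zero for `2`-power moduli -/

/-- **No real zeros near `1` for the characters mod `8`, uniformly**: there is `δ > 0` with
`L(σ, χ₀) ≠ 0` for all real `σ ≥ 1 − δ` and all `χ₀ ≠ 1` mod `8` ("it suffices to know that
`L(1, χ) ≠ 0` … This implies that `L(s, χ) ≠ 0` for `s ∈ [1 − c', 1]` for some `c'` by continuity";
Mathlib: `LFunction_apply_one_ne_zero`, `differentiable_LFunction`, and
`LFunction_ne_zero_of_one_le_re` for `σ ≥ 1`; there are finitely many `χ₀`).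
[cite: Green2012, proof of Theorem 3] -/
theorem exists_LFunction_mod_eight_ne_zero :
    ∃ δ : ℝ, 0 < δ ∧ ∀ χ₀ : DirichletCharacter ℂ 8, χ₀ ≠ 1 → ∀ σ : ℝ, 1 - δ ≤ σ →
      χ₀.LFunction σ ≠ 0 := by
  have key : ∀ χ₀ : DirichletCharacter ℂ 8, ∀ᶠ δ in 𝓝[>] (0 : ℝ), χ₀ ≠ 1 → ∀ σ : ℝ, 1 - δ ≤ σ →
      χ₀.LFunction σ ≠ 0 := by
    intro χ₀
    by_cases hχ : χ₀ = 1
    · exact Filter.Eventually.of_forall fun δ h ↦ absurd hχ h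
    · have hcont : ContinuousAt (fun σ : ℝ ↦ χ₀.LFunction σ) 1 :=
        ((differentiable_LFunction hχ).continuous.comp continuous_ofReal).continuousAt
      have hne : (fun σ : ℝ ↦ χ₀.LFunction σ) 1 ≠ 0 := by
        simp only [ofReal_one]
        exact LFunction_apply_one_ne_zero hχ
      obtain ⟨ε, hε, hball⟩ := Metric.eventually_nhds_iff.1 (hcont.eventually_ne hne)
      filter_upwards [Ioo_mem_nhdsGT hε] with δ hδ _ σ hσ
      by_cases h1 : 1 ≤ σ
      · exact LFunction_ne_zero_of_one_le_re χ₀ (Or.inl hχ) (by simpa using h1)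
      · exact hball (by rw [Real.dist_eq, abs_of_neg (by linarith)]; linarith [hδ.2])
  have hall : ∀ᶠ δ in 𝓝[>] (0 : ℝ), ∀ χ₀ : DirichletCharacter ℂ 8, χ₀ ≠ 1 → ∀ σ : ℝ,
      1 - δ ≤ σ → χ₀.LFunction σ ≠ 0 := Filter.eventually_all.2 key
  obtain ⟨δ, hδ, hδ0⟩ := (hall.and self_mem_nhdsWithin).exists
  exact ⟨δ, hδ0, hδ⟩

/-- **No exceptional zero for `2`-power moduli** (Green: for `q = 2^t` "there are no exceptional
zeros"): there is an absolute `δ > 0` such that every real zero `β` of `L(s, χ)`, `χ ≠ χ₀` mod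
`2^t` with `χ² = 1`, satisfies `β ≤ 1 − δ`. [cite: Green2012, proof of Theorem 3] -/
theorem exists_realZero_le :
    ∃ δ : ℝ, 0 < δ ∧ ∀ (t : ℕ) (χ : DirichletCharacter ℂ (2 ^ t)), χ ^ 2 = 1 → χ ≠ 1 →
      ∀ β : ℝ, χ.LFunction β = 0 → β ≤ 1 - δ := by
  obtain ⟨δ, hδ, h8⟩ := exists_LFunction_mod_eight_ne_zero
  refine ⟨δ, hδ, fun t χ hχ2 hχ1 β hβ ↦ ?_⟩
  by_contra hlt
  obtain ⟨χ₀, hχ₀, h0⟩ := exists_mod_eight_of_LFunction_eq_zero t χ hχ2 hχ1 hβ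
  exact h8 χ₀ hχ₀ β (by linarith [not_le.1 hlt]) h0

/-- The would-be exceptional term is negligible for `2`-power moduli: for `c' > 0` there is
`K₂ ≥ 1` with `x^β ≤ K₂ x e^{−c'√log x}` for all `x ≥ 1` and every real zero `β` of `L(s, χ)`,
`χ ≠ χ₀` mod `2^t` with `χ² = 1` (`x^β ≤ x^{1−δ}` by `exists_realZero_le`, and
`δ log x − c'√log x + c'²/(4δ) ≥ 0`; `K₂ = e^{c'²/(4δ)}`). [folklore] -/
theorem exists_rpow_realZero_le {c' : ℝ} (hc' : 0 < c') :
    ∃ K₂ : ℝ, 1 ≤ K₂ ∧ ∀ (t : ℕ) (χ : DirichletCharacter ℂ (2 ^ t)), χ ^ 2 = 1 → χ ≠ 1 →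
      ∀ β : ℝ, χ.LFunction β = 0 → ∀ x : ℝ, 1 ≤ x →
        x ^ β ≤ K₂ * x * Real.exp (-(c' * Real.sqrt (Real.log x))) := by
  obtain ⟨δ, hδ, hzero⟩ := exists_realZero_le
  refine ⟨Real.exp (c' ^ 2 / (4 * δ)), Real.one_le_exp (by positivity),
    fun t χ hχ2 hχ1 β hβ x hx ↦ ?_⟩
  have hβ1 := hzero t χ hχ2 hχ1 β hβ
  have hx0 : 0 < x := by linarith
  have hL0 : 0 ≤ Real.log x := Real.log_nonneg hx
  have h1 : x ^ β ≤ x ^ (1 - δ) := Real.rpow_le_rpow_of_exponent_le hx hβ1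
  have h2 : x ^ (1 - δ) = x * Real.exp (-(δ * Real.log x)) := by
    rw [Real.rpow_def_of_pos hx0, show Real.log x * (1 - δ) = Real.log x + -(δ * Real.log x) by
      ring, Real.exp_add, Real.exp_log hx0]
  have h3 : -(δ * Real.log x) ≤ c' ^ 2 / (4 * δ) + -(c' * Real.sqrt (Real.log x)) := by
    have hs : Real.sqrt (Real.log x) ^ 2 = Real.log x := Real.sq_sqrt hL0
    have hsq : 0 ≤ (c' - 2 * δ * Real.sqrt (Real.log x)) ^ 2 := sq_nonneg _
    have h4δ : 0 < 4 * δ := by positivity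
    have e : c' ^ 2 + -(c' * Real.sqrt (Real.log x)) * (4 * δ) - -(δ * Real.log x) * (4 * δ) =
        (c' - 2 * δ * Real.sqrt (Real.log x)) ^ 2 := by
      linear_combination (-(4 * δ ^ 2)) * hs
    have key : -(δ * Real.log x) * (4 * δ) ≤
        c' ^ 2 + -(c' * Real.sqrt (Real.log x)) * (4 * δ) := by linarith [hsq, e]
    calc -(δ * Real.log x) = -(δ * Real.log x) * (4 * δ) / (4 * δ) := by
          field_simp
      _ ≤ (c' ^ 2 + -(c' * Real.sqrt (Real.log x)) * (4 * δ)) / (4 * δ) :=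
          div_le_div_of_nonneg_right key h4δ.le
      _ = c' ^ 2 / (4 * δ) + -(c' * Real.sqrt (Real.log x)) := by
          field_simp
  calc x ^ β ≤ x ^ (1 - δ) := h1
    _ = x * Real.exp (-(δ * Real.log x)) := h2
    _ ≤ x * Real.exp (c' ^ 2 / (4 * δ) + -(c' * Real.sqrt (Real.log x))) :=
        mul_le_mul_of_nonneg_left (Real.exp_le_exp.2 h3) hx0.le
    _ = Real.exp (c' ^ 2 / (4 * δ)) * x * Real.exp (-(c' * Real.sqrt (Real.log x))) := by
        rw [Real.exp_add]; ring

/-! ## The core estimate for `Re(w M(x, χ))`, `χ` mod `2^t` -/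

/-- **The core estimate for `Re(w M(x, χ))`, `χ` mod `2^t`** (as
`MoebiusTwist.exists_core_bound`, i.e. Montgomery–Vaughan §11.3 Exercise 7 via the Riesz-mean
engine `ExcPsiData.exists_psi_bound` applied to `1 + λRe(wχ(n))μ(n)`, but with the exceptional
term killed by `exists_rpow_realZero_le` instead of Siegel's theorem): absolute `0 < c' ≤ 1`,
`K, D, K₂ ≥ 0` with, for all `t`, all `χ` mod `2^t`, all `|w| ≤ 1` and all `x ≥ 64` with
`log 2^t ≤ √log x`:
`|Re(w ∑_{n ≤ x} χ(n)μ(n))| ≤ (K log(4·2^t) + 1)((D 4^t + K₂) x e^{−c'√log x} + 1)`.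
[cite: Green2012, proof of Theorem 3] -/
theorem exists_core_bound :
    ∃ c' : ℝ, 0 < c' ∧ c' ≤ 1 ∧ ∃ K : ℝ, 0 ≤ K ∧ ∃ D : ℝ, 0 ≤ D ∧ ∃ K₂ : ℝ, 0 ≤ K₂ ∧
      ∀ (t : ℕ) (χ : DirichletCharacter ℂ (2 ^ t)) (w : ℂ), ‖w‖ ≤ 1 →
        ∀ x : ℝ, 64 ≤ x → Real.log ((2 ^ t : ℕ) : ℝ) ≤ Real.sqrt (Real.log x) →
          |(w * ∑ n ∈ Finset.Ioc 0 ⌊x⌋₊, χ (n : ZMod (2 ^ t)) * (μ n : ℂ)).re| ≤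
            (K * (Real.log ((2 ^ t : ℕ) : ℝ) + Real.log 4) + 1) *
              ((D * ((2 ^ t : ℕ) : ℝ) ^ 2 + K₂) * x *
                Real.exp (-(c' * Real.sqrt (Real.log x))) + 1) := by
  obtain ⟨c, hc, hc2, K, hK, C₀, hC₀, hdata⟩ := MoebiusTwist.exists_excPsiData_all
  obtain ⟨A₀, hA₀, hpsi⟩ := ExcPsiData.exists_psi_bound hc hc2
  obtain ⟨K₂, hK₂1, hzero⟩ := exists_rpow_realZero_le (c' := c / 80) (by positivity)
  refine ⟨c / 80, by positivity, by linarith, K, hK, A₀ * (C₀ + 1), by positivity, 2 * K₂,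
    by linarith, fun t χ w hw x hx hlogq ↦ ?_⟩
  obtain ⟨β, α, F, hcase, hD⟩ := hdata (2 ^ t) χ w hw
  have hb := hpsi hD x hx hlogq
  rw [MoebiusTwist.psi_coeff_eq] at hb
  set lam : ℝ := 1 / (K * (Real.log ((2 ^ t : ℕ) : ℝ) + Real.log 4) + 1) with hlam
  set S : ℂ := ∑ n ∈ Finset.Ioc 0 ⌊x⌋₊, χ (n : ZMod (2 ^ t)) * (μ n : ℂ) with hSdef
  set E : ℝ := Real.exp (-(c / 80 * Real.sqrt (Real.log x))) with hEdef
  have hE0 : 0 < E := Real.exp_pos _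
  have hx0 : 0 < x := by linarith
  have hq1 : (1 : ℝ) ≤ ((2 ^ t : ℕ) : ℝ) := by exact_mod_cast Nat.one_le_two_pow
  have hℒ₀ : 1 ≤ Real.log ((2 ^ t : ℕ) : ℝ) + Real.log 4 := PagePNT.one_le_ell0 (2 ^ t)
  have hden : 0 < K * (Real.log ((2 ^ t : ℕ) : ℝ) + Real.log 4) + 1 := by positivity
  have hlam0 : 0 < lam := by rw [hlam]; positivity
  -- `|⌊x⌋ − x| ≤ 1`
  have hfloor : |(⌊x⌋₊ : ℝ) - x| ≤ 1 := by
    rw [abs_sub_comm, abs_of_nonneg (sub_nonneg.2 (Nat.floor_le hx0.le))]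
    exact (sub_lt_iff_lt_add.2 (by linarith [Nat.lt_floor_add_one x])).le
  -- the exceptional term `|α| x^β/β ≤ 2 x^β ≤ 2 K₂ x E` (or `0`): no exceptional zero
  have hexc : |α * x ^ β / β| ≤ 2 * K₂ * x * E := by
    rcases hcase with hα0 | ⟨hχ1, hχ2, hβ⟩
    · rw [hα0, zero_mul, zero_div, abs_zero]; positivity
    · have hβhalf := hD.β_ge
      have hβpos : 0 < β := by linarith
      have hxβ : 0 < x ^ β := Real.rpow_pos_of_pos hx0 β
      have hS := hzero t χ hχ2 hχ1 β hβ x (by linarith)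
      rw [abs_div, abs_mul, abs_of_pos hβpos, abs_of_pos hxβ, div_le_iff₀ hβpos]
      calc |α| * x ^ β ≤ 1 * (K₂ * x * E) := mul_le_mul hD.α_le hS hxβ.le zero_le_one
        _ ≤ 2 * K₂ * x * E * β := by
            rw [one_mul]
            have : 0 ≤ K₂ * x * E := by
              have : 0 ≤ K₂ := by linarith
              positivity
            nlinarith
  -- `λ |Re(wS)| ≤ main + 1 + exceptional`
  have hkey : lam * |(w * S).re| ≤ A₀ * (C₀ * ((2 ^ t : ℕ) : ℝ) ^ 2 + 1) * x * E + 1 + 2 * K₂ * x * E := by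
    have heq : lam * (w * S).re = ((⌊x⌋₊ : ℝ) + lam * (w * S).re - (x - α * x ^ β / β)) +
        (x - (⌊x⌋₊ : ℝ)) - α * x ^ β / β := by ring
    rw [← abs_of_pos hlam0, ← abs_mul, heq]
    calc |((⌊x⌋₊ : ℝ) + lam * (w * S).re - (x - α * x ^ β / β)) + (x - (⌊x⌋₊ : ℝ)) - α * x ^ β / β|
        ≤ |((⌊x⌋₊ : ℝ) + lam * (w * S).re - (x - α * x ^ β / β)) + (x - (⌊x⌋₊ : ℝ))| +
            |α * x ^ β / β| := abs_sub _ _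
      _ ≤ (|(⌊x⌋₊ : ℝ) + lam * (w * S).re - (x - α * x ^ β / β)| + |x - (⌊x⌋₊ : ℝ)|) +
            |α * x ^ β / β| := add_le_add (abs_add_le _ _) le_rfl
      _ ≤ (A₀ * (C₀ * ((2 ^ t : ℕ) : ℝ) ^ 2 + 1) * x * E + 1) + 2 * K₂ * x * E := by
          refine add_le_add (add_le_add hb ?_) hexc
          rw [abs_sub_comm]; exact hfloor
      _ = _ := by ring
  -- divide by `λ` and simplify the constants
  have hq2 : (1 : ℝ) ≤ ((2 ^ t : ℕ) : ℝ) ^ 2 := one_le_pow₀ hq1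
  have hmono : A₀ * (C₀ * ((2 ^ t : ℕ) : ℝ) ^ 2 + 1) ≤ A₀ * (C₀ + 1) * ((2 ^ t : ℕ) : ℝ) ^ 2 := by
    have : A₀ * (C₀ + 1) * ((2 ^ t : ℕ) : ℝ) ^ 2 = A₀ * (C₀ * ((2 ^ t : ℕ) : ℝ) ^ 2 + ((2 ^ t : ℕ) : ℝ) ^ 2) := by ring
    rw [this]
    exact mul_le_mul_of_nonneg_left (by linarith) hA₀.le
  have hxE : 0 ≤ x * E := by positivity
  calc |(w * S).re| = (K * (Real.log ((2 ^ t : ℕ) : ℝ) + Real.log 4) + 1) * (lam * |(w * S).re|) := by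
        rw [hlam]; field_simp
    _ ≤ (K * (Real.log ((2 ^ t : ℕ) : ℝ) + Real.log 4) + 1) *
          (A₀ * (C₀ * ((2 ^ t : ℕ) : ℝ) ^ 2 + 1) * x * E + 1 + 2 * K₂ * x * E) :=
        mul_le_mul_of_nonneg_left hkey hden.le
    _ ≤ (K * (Real.log ((2 ^ t : ℕ) : ℝ) + Real.log 4) + 1) *
          ((A₀ * (C₀ + 1) * ((2 ^ t : ℕ) : ℝ) ^ 2 + 2 * K₂) * x * E + 1) := by
        refine mul_le_mul_of_nonneg_left ?_ hden.le
        have := mul_le_mul_of_nonneg_right hmono hxE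
        nlinarith

end MoebiusTwoPower

/-! ## Green's Theorem 3 -/

open MoebiusTwoPower MoebiusTwist in
set_option maxHeartbeats 1600000 in
/-- **Green 2012, Theorem 3, PROVED**: the named fact
`Literature.NumberTheory.LFunctions.green_moebius_character_twoPower` holds — there are an absolute
`c₂ > 0` and `K` with `‖∑_{0 ≤ x < N} μ(x)χ(x)‖ ≤ K N e^{−c₂√log N}` for all `t, N`, all Dirichlet
characters `χ` mod `2^t` with `2^t ≤ e^{c₂√log N}`. Proof as printed by Green: the twisted-Möbius
prime number theorem in the range `q ≤ e^{c√log N}` absent an exceptional zero (Montgomery–Vaughan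
§11.3 Exercise 7; here the tree's Landau engine `MoebiusTwoPower.exists_core_bound`, with
`c₂ = c'/4`) and the absence of exceptional zeros for `2`-power conductors
(`MoebiusTwoPower.exists_realZero_le`); `N < 64` is trivial, and the term `x = N` has modulus
`≤ 1`. [cite: Green2012, Theorem 3] -/
theorem green_moebius_character_twoPower_holds : green_moebius_character_twoPower := by
  obtain ⟨c', hc', hc'1, K, hK, D, hD, K₂, hK₂, hcore⟩ := MoebiusTwoPower.exists_core_bound
  -- constants
  set a : ℝ := c' / 4 with hadef
  have ha0 : 0 < a := by positivity
  have ha1 : a ≤ 1 := by rw [hadef]; linarith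
  set M₂ : ℝ := (2 * 1).factorial / a ^ (2 * 1) with hM₂
  have hM₂0 : 0 ≤ M₂ := by positivity
  set K₁ : ℝ := K * (a + 3) + 1 with hK₁
  have hK₁0 : 0 < K₁ := by positivity
  set Cbig : ℝ := 2 * K₁ * ((D + K₂) * M₂ + 1) + 1 with hCbig
  have hCbig0 : 0 ≤ Cbig := by positivity
  set Csmall : ℝ := Real.exp (a * Real.sqrt (Real.log 64)) with hCsmall
  have hCsmall0 : 0 ≤ Csmall := (Real.exp_pos _).le
  refine ⟨a, ha0, Cbig + Csmall, fun t N χ hqexp ↦ ?_⟩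
  set f : ℕ → ℂ := fun n ↦ ((μ n : ℤ) : ℂ) * χ (n : ZMod (2 ^ t)) with hf
  have hf1 : ∀ n, ‖f n‖ ≤ 1 := by
    intro n
    rw [hf, norm_mul, Complex.norm_intCast]
    calc |((μ n : ℤ) : ℝ)| * ‖χ (n : ZMod (2 ^ t))‖ ≤ 1 * 1 := by
          gcongr
          · exact_mod_cast ArithmeticFunction.abs_moebius_le_one
          · exact DirichletCharacter.norm_le_one χ _
      _ = 1 := one_mul _
  have htriv : ‖∑ n ∈ range N, f n‖ ≤ N := by
    calc ‖∑ n ∈ range N, f n‖ ≤ ∑ n ∈ range N, ‖f n‖ := norm_sum_le _ _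
      _ ≤ ∑ n ∈ range N, (1 : ℝ) := Finset.sum_le_sum fun n _ ↦ hf1 n
      _ = N := by simp
  set L : ℝ := Real.log N with hL
  set E : ℝ := Real.exp (-(a * Real.sqrt L)) with hEdef
  have hE0 : 0 < E := Real.exp_pos _
  have hN0 : (0 : ℝ) ≤ N := Nat.cast_nonneg N
  rcases lt_or_ge (N : ℝ) 64 with hN64 | hN64
  · -- small `N`: `‖∑‖ ≤ N ≤ Csmall N E`
    have hLle : L ≤ Real.log 64 := by
      rcases Nat.eq_zero_or_pos N with h0 | hpos
      · rw [hL, h0, Nat.cast_zero, Real.log_zero]; exact Real.log_nonneg (by norm_num)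
      · exact Real.log_le_log (by exact_mod_cast hpos) hN64.le
    have h1 : 1 ≤ Csmall * E := by
      rw [hCsmall, hEdef, ← Real.exp_add]
      refine Real.one_le_exp ?_
      have : Real.sqrt L ≤ Real.sqrt (Real.log 64) := Real.sqrt_le_sqrt hLle
      nlinarith
    calc ‖∑ n ∈ range N, f n‖ ≤ N := htriv
      _ ≤ N * (Csmall * E) := le_mul_of_one_le_right hN0 h1
      _ = Csmall * N * E := by ring
      _ ≤ (Cbig + Csmall) * N * E := by
          have : 0 ≤ Cbig * N * E := by positivity
          nlinarith
  · -- large `N`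
    have hN0' : (0 : ℝ) < N := by linarith
    have hL1 : 1 ≤ L := by
      rw [hL, ← Real.log_exp 1]
      refine Real.log_le_log (Real.exp_pos 1) ?_
      have := Real.exp_one_lt_d9; linarith
    have hL0 : 0 < L := by linarith
    have hsqrt1 : 1 ≤ Real.sqrt L := Real.one_le_sqrt.2 hL1
    -- from the hypothesis: `log q ≤ a√L ≤ √L` and `q² ≤ e^{2a√L}`
    have hqR : ((2 ^ t : ℕ) : ℝ) = (2 : ℝ) ^ t := by norm_num
    have hq0 : (0 : ℝ) < (2 : ℝ) ^ t := by positivity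
    have hlogq : Real.log ((2 ^ t : ℕ) : ℝ) ≤ a * Real.sqrt L := by
      rw [hqR]
      calc Real.log ((2 : ℝ) ^ t) ≤ Real.log (Real.exp (a * Real.sqrt L)) :=
            Real.log_le_log hq0 hqexp
        _ = a * Real.sqrt L := Real.log_exp _
    have hlogq' : Real.log ((2 ^ t : ℕ) : ℝ) ≤ Real.sqrt L := by
      refine hlogq.trans ?_
      calc a * Real.sqrt L ≤ 1 * Real.sqrt L :=
            mul_le_mul_of_nonneg_right ha1 (Real.sqrt_nonneg _)
        _ = Real.sqrt L := one_mul _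
    have hq2 : ((2 ^ t : ℕ) : ℝ) ^ 2 ≤ Real.exp (2 * a * Real.sqrt L) := by
      rw [hqR]
      calc ((2 : ℝ) ^ t) ^ 2 ≤ (Real.exp (a * Real.sqrt L)) ^ 2 :=
            pow_le_pow_left₀ hq0.le hqexp 2
        _ = Real.exp (2 * a * Real.sqrt L) := by rw [sq, ← Real.exp_add]; ring_nf
    -- the core bound at `x = N` for `w = 1` and `w = −i`
    have hfloor : ⌊(N : ℝ)⌋₊ = N := Nat.floor_natCast N
    have hB1 := hcore t χ 1 (by simp) N hN64 hlogq'
    have hB2 := hcore t χ (-I) (by simp) N hN64 hlogq'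
    rw [hfloor] at hB1 hB2
    set S : ℂ := ∑ n ∈ Finset.Ioc 0 N, χ (n : ZMod (2 ^ t)) * (μ n : ℂ) with hSdef
    rw [one_mul] at hB1
    have hre2 : (-I * S).re = S.im := by simp
    rw [hre2] at hB2
    set E' : ℝ := Real.exp (-(c' * Real.sqrt (Real.log N))) with hE'
    have hE'0 : 0 < E' := Real.exp_pos _
    set B : ℝ := (K * (Real.log ((2 ^ t : ℕ) : ℝ) + Real.log 4) + 1) *
      ((D * ((2 ^ t : ℕ) : ℝ) ^ 2 + K₂) * N * E' + 1) with hBdef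
    have hnormS : ‖S‖ ≤ 2 * B := by
      calc ‖S‖ ≤ |S.re| + |S.im| := Complex.norm_le_abs_re_add_abs_im S
        _ ≤ B + B := add_le_add hB1 hB2
        _ = 2 * B := by ring
    -- Green's range `0 ≤ x ≤ N − 1` versus `1 ≤ n ≤ N`
    have hsum : ∑ n ∈ range N, f n = S - f N := by
      have h0 : ∑ n ∈ Finset.Ioc 0 N, f n = ∑ n ∈ range (N + 1), f n := by
        apply Finset.sum_subset
        · intro n hn
          simp only [Finset.mem_Ioc, Finset.mem_range] at hn ⊢
          omega
        · intro n hn hn'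
          simp only [Finset.mem_Ioc, Finset.mem_range, not_and, not_le] at hn hn'
          have hn0 : n = 0 := by omega
          simp [hf, hn0]
      have h1 : S = ∑ n ∈ Finset.Ioc 0 N, f n := by
        rw [hSdef, hf]
        exact Finset.sum_congr rfl fun n _ ↦ mul_comm _ _
      rw [h1, h0, Finset.sum_range_succ, add_sub_cancel_right]
    -- sizes: `K log 4q + 1 ≤ K₁ √L`, `(D q² + K₂) E' ≤ (D + K₂) E²`
    have hlog4 : Real.log 4 ≤ 3 := by
      have := Real.log_le_sub_one_of_pos (by norm_num : (0 : ℝ) < 4); linarith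
    have hfac1 : K * (Real.log ((2 ^ t : ℕ) : ℝ) + Real.log 4) + 1 ≤ K₁ * Real.sqrt L := by
      have h1 : Real.log ((2 ^ t : ℕ) : ℝ) + Real.log 4 ≤ (a + 3) * Real.sqrt L := by nlinarith
      have h2 := mul_le_mul_of_nonneg_left h1 hK
      rw [hK₁]; nlinarith
    have hEE : E' = (E * E) * (E * E) := by
      rw [hE', hEdef]
      simp only [← Real.exp_add]
      congr 1
      rw [hadef, hL]; ring
    have hq2E : ((2 ^ t : ℕ) : ℝ) ^ 2 * (E * E) ≤ 1 := by
      have h1 : Real.exp (2 * a * Real.sqrt L) * (E * E) = 1 := by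
        rw [hEdef]
        simp only [← Real.exp_add]
        rw [← Real.exp_zero]
        congr 1; ring
      calc ((2 ^ t : ℕ) : ℝ) ^ 2 * (E * E) ≤ Real.exp (2 * a * Real.sqrt L) * (E * E) :=
            mul_le_mul_of_nonneg_right hq2 (by positivity)
        _ = 1 := h1
    have hmain : (D * ((2 ^ t : ℕ) : ℝ) ^ 2 + K₂) * N * E' ≤ (D + K₂) * N * (E * E) := by
      rw [hEE]
      have h1 : D * ((2 ^ t : ℕ) : ℝ) ^ 2 * (E * E) ≤ D := by
        calc D * ((2 ^ t : ℕ) : ℝ) ^ 2 * (E * E) = D * (((2 ^ t : ℕ) : ℝ) ^ 2 * (E * E)) := by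
              ring
          _ ≤ D * 1 := mul_le_mul_of_nonneg_left hq2E hD
          _ = D := mul_one _
      have hE1 : E ≤ 1 := by
        rw [hEdef]; exact Real.exp_le_one_iff.2 (neg_nonpos.2 (by positivity))
      have h2 : K₂ * (E * E) ≤ K₂ := by
        refine mul_le_of_le_one_right hK₂ ?_
        nlinarith
      have hNEE : 0 ≤ (N : ℝ) * (E * E) := by positivity
      calc (D * ((2 ^ t : ℕ) : ℝ) ^ 2 + K₂) * N * ((E * E) * (E * E))
          = (D * ((2 ^ t : ℕ) : ℝ) ^ 2 * (E * E) + K₂ * (E * E)) * (N * (E * E)) := by ring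
        _ ≤ (D + K₂) * (N * (E * E)) := mul_le_mul_of_nonneg_right (add_le_add h1 h2) hNEE
        _ = (D + K₂) * N * (E * E) := by ring
    -- `√L E ≤ M₂` and `√L ≤ N E`
    have hp2 : Real.sqrt L * E ≤ M₂ := by
      calc Real.sqrt L * E ≤ L * E := by
            refine mul_le_mul_of_nonneg_right ?_ hE0.le
            have h := Real.sq_sqrt hL0.le
            nlinarith
        _ = L ^ 1 * E := by ring
        _ ≤ M₂ := pow_mul_exp_neg_sqrt_le ha0 hL0.le 1
    have hp3 : Real.sqrt L ≤ N * E := sqrt_log_le_mul_exp hN0' hL1 ha1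
    -- assemble
    have hNE : 0 ≤ (N : ℝ) * E := by positivity
    have h2B : 2 * B + 1 ≤ Cbig * N * E := by
      have hstep1 : B ≤ K₁ * Real.sqrt L * ((D + K₂) * N * (E * E) + 1) := by
        rw [hBdef]
        exact mul_le_mul hfac1 (by linarith) (by positivity) (by positivity)
      have hstep2 : Real.sqrt L * ((D + K₂) * N * (E * E) + 1) ≤
          ((D + K₂) * M₂ + 1) * (N * E) := by
        have e : Real.sqrt L * ((D + K₂) * N * (E * E) + 1) =
            (D + K₂) * (Real.sqrt L * E) * (N * E) + Real.sqrt L := by ring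
        rw [e]
        have h1 : (D + K₂) * (Real.sqrt L * E) * (N * E) ≤ (D + K₂) * M₂ * (N * E) :=
          mul_le_mul_of_nonneg_right (mul_le_mul_of_nonneg_left hp2 (by positivity)) hNE
        nlinarith
      have hstep3 := mul_le_mul_of_nonneg_left hstep2 (by positivity : (0 : ℝ) ≤ 2 * K₁)
      calc 2 * B + 1 ≤ 2 * (K₁ * Real.sqrt L * ((D + K₂) * N * (E * E) + 1)) + N * E := by
            linarith
        _ = 2 * K₁ * (Real.sqrt L * ((D + K₂) * N * (E * E) + 1)) + N * E := by ring
        _ ≤ 2 * K₁ * (((D + K₂) * M₂ + 1) * (N * E)) + N * E := by linarith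
        _ = Cbig * N * E := by rw [hCbig]; ring
    calc ‖∑ n ∈ range N, f n‖ = ‖S - f N‖ := by rw [hsum]
      _ ≤ ‖S‖ + ‖f N‖ := norm_sub_le _ _
      _ ≤ 2 * B + 1 := add_le_add hnormS (hf1 N)
      _ ≤ Cbig * N * E := h2B
      _ ≤ (Cbig + Csmall) * N * E := by
          have : 0 ≤ Csmall * N * E := by positivity
          nlinarith

end Literature.NumberTheory.LFunctions
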